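import Summits.ValiantsHypothesis.ValiantsHypothesis.Theorems.KPlusLogSqLawTridiagonalRealStaticPotentialGameDefs
import Summits.ValiantsHypothesis.ValiantsHypothesis.Theorems.KPlusLogSqLawTridiagonalRealStaticPotentialLawRefuted

/-!
# Route «KPlusLogSqLaw», crux `WeakLifting` (stmt-ValiantsHypothesis-19561) — REAL side of the tridiagonal sector:
# the root-word sequence of a real design is NOT a relaxed play (the relaxed word game does not dominate one-edge steps)

HONEST FRAMING.  Helper (`--supports stmt-ValiantsHypothesis-19561 --as helper`), seat val-sym-lift-p1 (g13), cell `pub-symmetroid`,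
2026-08-28; companion of `…TridiagonalRealStaticPotentialLawRefuted` (conjecture (P) is false).  The RELAXED WORD GAME
(`…TridiagonalRealStaticPotentialGameDefs.IsRelaxedMove`, lift-p3 g10; the kernel cap `count_true_le_of_relaxedReach`: `#q ≤ 2n` after `n` moves)
models ONE appended edge in the hierarchical limit as one move `w ↦ φ(u) ++ T ++ ψ(v)` on the root word.  Its FAITHFULNESS to finite designs was
located/paper only (memo HIERARCHICAL-LIMIT-GAME-liftp3g9.md §1) and was the bridge by which the cap would bound real designs step by step.
THIS FILE SHOWS THE BRIDGE FAILS AT FINITE SPEED: for the `5 × 5` witness of the (P)-refutation (`a ≡ 1`, `d = (8,0,2,1,1)`,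
`b = (17/10, 17, 10, 9/25)`, `f = (0,0,8,9)`) the root word of `(D₃, D₄)` is the one-letter word `[p]` (`D₃` has exactly one positive zero,
`D₄` none), from which every relaxed move produces at most TWO letters `q` (`count_true_le_two_of_isRelaxedMove_singleton_false`), whereas the
root word of `(D₄, D₅)` has at least FOUR letters `q` (`D₅` has four positive zeros): `not_isRelaxedMove_witness`,
`not_forall_isRelaxedMove_rootWords`.  So NEITHER the potential law (P) NOR step-wise simulation by the relaxed game transfers the model's cap
`2(m − 1)` to real designs; only GLOBAL statements (the chain form «`Θ(rootWord D_{m−1} D_m) ≤ 2(m − 1)`», the row `Z ≤ 2m − 2` itself) remain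
as candidates — neither is refuted here.  Nothing here bears on `WeakLifting` / `TropicalB` (stmt-19771) in their windows, on Conjecture B, on
the Door-A registers, on `MatrixDescartes` (stmt-ValiantsHypothesis-18050) or on VP ≠ VNP.
[this cell's memo HIERARCHICAL-LIMIT-GAME-liftp3g9.md §1/§3b (the game), its step-faithfulness REFUTED here at finite speed; folklore otherwise]
-/

-- `Summit.ValiantsHypothesis.ValiantsHypothesis.…` repeats a component by the D-0017 layout (single-conjunct summit); the name is mandated.
set_option linter.dupNamespace false
set_option autoImplicit false

namespace Summit.ValiantsHypothesis.ValiantsHypothesis.Theorems.KPlusLogSqLaw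

namespace StaticTridiagonalRealCut

open Polynomial
open Summit.ValiantsHypothesis.ValiantsHypothesis.Theorems.KPlusLogSqLaw.StaticTridiagonalRealPotential
  (pathDet pathDet_zero pathDet_one pathDet_add_two rootWord IsRelaxedMove pairWord swapWord length_rootWord count_true_rootWord
    card_posRoots_le_count_true)

/-- From the one-letter word `[p]` a relaxed move (of either type) produces at most two letters `q`
(`φ([p]) = []`, `ψ([p]) = [q]`, `T ∈ {[], [q]}`). [bookkeeping on lift-p3 g10's `IsRelaxedMove`] -/
theorem count_true_le_two_of_isRelaxedMove_singleton_false {w' : List Bool} (h : IsRelaxedMove [false] w') :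
    w'.count true ≤ 2 := by
  obtain ⟨u, v, o, T, hT, hmove⟩ := h
  have key : ∀ u v : List Bool, u ++ v = [false] → (pairWord u o ++ T ++ swapWord v).count true ≤ 2 := by
    intro u v huv
    rcases List.append_eq_singleton_iff.1 huv with ⟨rfl, rfl⟩ | ⟨rfl, rfl⟩
    · rcases hT with rfl | rfl <;> simp [pairWord, swapWord]
    · rcases hT with rfl | rfl <;> simp [pairWord, swapWord]
  rcases hmove with ⟨hw, rfl⟩ | ⟨hw, rfl⟩
  · exact key u v hw.symm
  · rw [List.count_reverse]
    refine key u v ?_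
    have h' := congrArg List.reverse hw
    simp only [List.reverse_cons, List.reverse_nil, List.nil_append, List.reverse_reverse] at h'
    exact h'.symm

/-- **THE ROOT-WORD SEQUENCE OF A REAL DESIGN IS NOT A RELAXED PLAY.**  For the static definite tridiagonal `5 × 5` design `a ≡ 1`,
`d = (8,0,2,1,1)`, `b = (17/10,17,10,9/25)`, `f = (0,0,8,9)` (nonzero links): `rootWord D₃ D₄ = [p]` but `rootWord D₄ D₅` has at least four
letters `q`, so the step `(D₃, D₄) ↦ (D₄, D₅)` is not a relaxed move. [this file] -/
theorem not_isRelaxedMove_witness : ∃ (a : ℕ → ℝ) (d : ℕ → ℕ) (b : ℕ → ℝ) (f : ℕ → ℕ), (∀ t, 0 < a t) ∧ (∀ t, b t ≠ 0) ∧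
    ¬ IsRelaxedMove (rootWord (pathDet a d b f 3) (pathDet a d b f 4)) (rootWord (pathDet a d b f 4) (pathDet a d b f 5)) := by
  classical
  set af : ℕ → ℝ := fun _ => 1 with haf
  set df : ℕ → ℕ := fun t => if t = 0 then 8 else if t = 1 then 0 else if t = 2 then 2 else 1 with hdf
  set bf : ℕ → ℝ := fun t => if t = 0 then 17 / 10 else if t = 1 then 17 else if t = 2 then 10 else if t = 3 then 9 / 25 else 1
    with hbf
  set ff : ℕ → ℕ := fun t => if t = 2 then 8 else if t = 3 then 9 else 0 with hff
  have ha : ∀ t, 0 < af t := fun t => by simp [haf]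
  have hb : ∀ t, bf t ≠ 0 := by intro t; simp only [hbf]; split_ifs <;> norm_num
  refine ⟨af, df, bf, ff, ha, hb, ?_⟩
  set D : ℕ → ℝ[X] := pathDet af df bf ff with hDdef
  have av : ∀ t, af t = 1 := fun t => by simp [haf]
  have d4 : df 4 = 1 := by simp [hdf]
  have b3 : bf 3 = 9 / 25 := by simp [hbf]
  have f3 : ff 3 = 9 := by simp [hff]
  have hD0 : D 0 = 1 := pathDet_zero _ _ _ _
  have hrec : ∀ (n : ℕ) (x : ℝ), (D (n + 2)).eval x =
      af (n + 1) * x ^ df (n + 1) * (D (n + 1)).eval x - (bf n * x ^ ff n) ^ 2 * (D n).eval x := by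
    intro n x
    rw [hDdef, pathDet_add_two]
    simp only [eval_sub, eval_mul, eval_pow, eval_C, eval_X]
  have hev1 : ∀ x : ℝ, (D 1).eval x = x ^ 8 := by
    intro x; rw [hDdef, pathDet_one]; norm_num [haf, hdf]
  have hev2 : ∀ x : ℝ, (D 2).eval x = x ^ 8 - 289 / 100 := by
    intro x; rw [hrec 0 x, hev1, hD0]; norm_num [haf, hdf, hbf, hff]
  have hev3 : ∀ x : ℝ, (D 3).eval x = x ^ 10 - 289 * x ^ 8 - 289 / 100 * x ^ 2 := by
    intro x; rw [hrec 1 x, hev2, hev1]; norm_num [haf, hdf, hbf, hff]; ring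
  have hev4 : ∀ x : ℝ, (D 4).eval x = x ^ 11 - 289 * x ^ 9 - 289 / 100 * x ^ 3 - 100 * x ^ 24 + 289 * x ^ 16 := by
    intro x; rw [hrec 2 x, hev3, hev2]; norm_num [haf, hdf, hbf, hff]; ring
  have hev5 : ∀ x : ℝ, (D 5).eval x = x * (x ^ 11 - 289 * x ^ 9 - 289 / 100 * x ^ 3 - 100 * x ^ 24 + 289 * x ^ 16)
      - 81 / 625 * x ^ 18 * (x ^ 10 - 289 * x ^ 8 - 289 / 100 * x ^ 2) := by
    intro x; rw [hrec 3 x]; simp only [Nat.reduceAdd, av, d4, b3, f3, hev4, hev3]; ring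
  have hD3 : D 3 = X ^ 10 - C (289 : ℝ) * X ^ 8 - C (289 / 100 : ℝ) * X ^ 2 :=
    Polynomial.funext fun x => by rw [hev3]; simp [eval_sub, eval_mul, eval_pow, eval_C, eval_X]
  have hD3ne : D 3 ≠ 0 := fun h => by have := hev3 1; rw [h, eval_zero] at this; norm_num at this
  have hD4ne : D 4 ≠ 0 := fun h => by have := hev4 1; rw [h, eval_zero] at this; norm_num at this
  have hD5ne : D 5 ≠ 0 := fun h => by have := hev5 1; rw [h, eval_zero] at this; norm_num at this
  -- `rootWord D₃ D₄ = [p]`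
  have h3 : (D 3).roots.countP (fun x => 0 < x) = 1 := by rw [hD3]; exact countP_roots_pos_D3_explicit
  have h4 : (D 4).roots.countP (fun x => 0 < x) = 0 := by
    rw [Multiset.countP_eq_zero]
    intro x hx hxpos
    have hroot := (mem_roots hD4ne).1 hx
    have hval := eval_D4_explicit_neg x hxpos
    rw [IsRoot.def, hev4] at hroot
    linarith
  have hlen : (rootWord (D 3) (D 4)).length = 1 := by rw [length_rootWord (mul_ne_zero hD3ne hD4ne), h3, h4]
  have hcount : (rootWord (D 3) (D 4)).count true = 0 := by
    rw [count_true_rootWord]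
    refine Finset.sum_eq_zero fun x hx => ?_
    rw [Finset.mem_filter] at hx
    refine Polynomial.rootMultiplicity_eq_zero fun hroot => ?_
    have hval := eval_D4_explicit_neg x hx.2
    rw [IsRoot.def, hev4] at hroot
    linarith
  obtain ⟨c, hc⟩ := List.length_eq_one_iff.1 hlen
  have hword : rootWord (D 3) (D 4) = [false] := by
    rw [hc] at hcount ⊢
    cases c
    · rfl
    · simp at hcount
  -- `rootWord D₄ D₅` has at least four letters `q`
  have hs1 : (D 5).eval 1 < 0 := by rw [hev5]; norm_num
  have hs2 : 0 < (D 5).eval (11 / 10) := by rw [hev5]; norm_num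
  have hs3 : (D 5).eval 2 < 0 := by rw [hev5]; norm_num
  have hs4 : 0 < (D 5).eval 8 := by rw [hev5]; norm_num
  have hs5 : (D 5).eval 32 < 0 := by rw [hev5]; norm_num
  have h5 : 4 ≤ ((D 5).roots.toFinset.filter (fun t => 0 < t)).card := by
    refine Summit.ValiantsHypothesis.ValiantsHypothesis.Theorems.SymmetroidDescartes.le_card_posRoots_of_alternating
      (D 5) 4 ![1, 11 / 10, 2, 8, 32] ?_ ?_ ?_
    · refine Fin.strictMono_iff_lt_succ.2 fun j => ?_
      fin_cases j <;> simp <;> norm_num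
    · intro j; fin_cases j <;> simp
    · intro j
      fin_cases j
      · simpa using mul_neg_of_neg_of_pos hs1 hs2
      · simpa using mul_neg_of_pos_of_neg hs2 hs3
      · simpa using mul_neg_of_neg_of_pos hs3 hs4
      · simpa using mul_neg_of_pos_of_neg hs4 hs5
  have h45 : 4 ≤ (rootWord (D 4) (D 5)).count true :=
    h5.trans (card_posRoots_le_count_true (mul_ne_zero hD4ne hD5ne))
  intro hmove
  rw [hword] at hmove
  have h2 := count_true_le_two_of_isRelaxedMove_singleton_false hmove
  omega

/-- **STEP-FAITHFULNESS OF THE RELAXED GAME IS FALSE**: it is not the case that, for every static definite symmetric tridiagonal design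
with nonzero links, consecutive root words are linked by relaxed moves. [corollary] -/
theorem not_forall_isRelaxedMove_rootWords :
    ¬ (∀ (a : ℕ → ℝ) (d : ℕ → ℕ) (b : ℕ → ℝ) (f : ℕ → ℕ), (∀ t, 0 < a t) → (∀ t, b t ≠ 0) →
      ∀ k : ℕ, IsRelaxedMove (rootWord (pathDet a d b f (k + 1)) (pathDet a d b f (k + 2)))
        (rootWord (pathDet a d b f (k + 2)) (pathDet a d b f (k + 3)))) := by
  intro h
  obtain ⟨a, d, b, f, ha, hb, hnot⟩ := not_isRelaxedMove_witness
  exact hnot (h a d b f ha hb 2)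

end StaticTridiagonalRealCut

end Summit.ValiantsHypothesis.ValiantsHypothesis.Theorems.KPlusLogSqLaw
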